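import Literature.AlgebraicGeometry.HodgeTheory.ComplexTorusProjectiveRiemannForm
import Literature.Geometry.Kaehler.ComplexTorusFirstCohomologyDuality
import Literature.Geometry.Kaehler.ComplexTorusFirstCohomologyPolarization
import Literature.AlgebraicGeometry.Motives.WeilTypePolarization
import HarnessLib

/-!
# A complex torus whose weight-one Hodge structure is polarisable admits a Riemann form

C. Voisin, *Hodge Theory and Complex Algebraic Geometry I*, §7.2.2 Lemma 7.15 (a polarisation of the
weight-one Hodge structure of a torus is a Riemann form) and the sentence after it: "a complex torus is an
abelian variety if and only if its weight `1` Hodge structure is polarisable"; H. Lange, Ch. Birkenhake,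
*Complex Abelian Varieties*, §4.2 Thm. 4.2.1 with §2.1 Thm. 2.1.13 and §2.4–§2.5 (the dual polarisation).
In the tree's language: let `T = E/Φ(ℤ^ι)` be a complex torus (`ComplexTorus Φ`, `Φ : ℝ^ι ≃ E` a period
isomorphism) and `H¹(T, ℚ) = ComplexTorus.rationalForms Φ 1` its first rational cohomology on the FORMS
carrier, with the weight-one `ℚ`-Hodge structure `ComplexTorus.hodgeStructure Φ 1` of
`Geometry/Kaehler/ComplexTorusRationalHodgeStructure` (`H^{1,0}` = the `ℂ`-linear one-forms). Then

* `isAbelianVariety_of_isPolarizable_hodgeStructure_one` — **if `H¹(T, ℚ)` is polarisable then `T` is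
  an abelian variety** (`ComplexTorus.IsAbelianVariety Φ`: a Riemann form exists);
* `isAbelianVariety_iff_isPolarizable_hodgeStructure_one` — for `dim_ℂ E > 0` the two are EQUIVALENT
  (the converse is the tree's `ComplexTorus.IsRiemannForm.isPolarizable_hodgeStructure_one'`,
  `Geometry/Kaehler/ComplexTorusFirstCohomologyPolarization`);
* `isAbelianVariety_of_hom_injective` — the consumer form: an INJECTIVE morphism of `ℚ`-Hodge
  structures `H¹(T, ℚ) → H` into any polarisable Hodge structure `H` of weight one makes `T` an abelian
  variety (pull the polarisation back, `Motives.HodgeStructure.Polarization.comap`);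
  `isAbelianVariety_of_hom_hodgeModel_injective` — the same with `H = H¹(X(ℂ); ℚ)` of a smooth
  projective `X` (weight-one Hodge structure of a Hodge-symmetric Hodge model, polarised by
  `smoothProjective_hodgeStructure_isPolarizable_holds`), e.g. the pull-back `α^*` along a holomorphic
  map `X^an → T` surjective on `π₁` — the situation of an Albanese map.

This generalises `isAbelianVariety_of_isAnalytification` (`HodgeTheory/ComplexTorusProjectiveRiemannForm`:
the torus IS the analytification of a smooth projective variety) from "is projective" to "`H¹` is
polarisable"; steps 2–4 of that file are reused BY NAME.

## Proof

1. COORDINATES (`baseChange_periodCoord_eq_sum`). The period coordinates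
   `u : H¹(T, ℚ) ≃ ℚ^ι`, `α ↦ (α(Φ e_b))_b` (`ComplexTorus.periodDual` of
   `Geometry/Kaehler/ComplexTorusFirstCohomologyDuality` followed by the dual-basis coordinates), and
   their complexification: `(u ⊗ ℂ) x = Σ_b (Θ x)(Φ e_b) ⊗ e_b`, `Θ` the comparison
   `ℂ ⊗_ℚ H¹(T, ℚ) ≅ H¹(T, ℂ) = Alt¹_ℝ(E; ℂ)` (`ComplexTorus.complexification`).
2. COHOMOLOGY RIEMANN DATA (`exists_cohomologyRiemannData_of_isPolarizable`): transport the Hodge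
   structure to `ℚ^ι` along `u` (`HodgeStructure.comapEquiv`; polarisability and effectivity are
   transported, `IsPolarizable.comapEquiv`, `IsEffective.comapEquiv`,
   `ComplexTorus.isEffective_hodgeStructure`), apply Riemann's linear algebra
   (`exists_cx_riemannForm_of_isPolarizable`, Voisin Lemma 7.15: a complex structure `J` on `ℝ ⊗ ℚ^ι`
   with `F¹ = {a + iJa}` and a rational `J`-invariant alternating form `Q` with `Q_ℝ(a, Ja) > 0`), read
   everything in `ℝ^ι`, and read `F¹ H¹(T) = Λ^{1,0} = Hom_ℂ(E, ℂ)`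
   (`ComplexTorus.mem_hodgeStructure_one_F_one_iff`, `typeOneZeroEquiv`) through `u`: every
   `a ∈ ℝ^ι` has a `ℂ`-linear `ℓ` with `ℓ(Φ e_b) = a_b + i (Ja)_b`. This is exactly the data tuple of
   `exists_cohomologyRiemannData_of_isAnalytification`.
3. `J = -J_Φᵀ` (`dotProduct_latticeJ_eq_neg`), DUALISATION (`LinearAlgebra.exists_dualRiemannData`,
   Lange–Birkenhake §2.4–§2.5), clearing denominators (`exists_nat_pos_mul_eq_int`) and
   `ComplexTorus.isAbelianVariety_of_bilinForm` — verbatim as in `isAbelianVariety_of_isAnalytification`.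

Everything is proved; no definition, no named fact (net debt 0). Cell `pub-hodgecm2` (COR-CM), seat b01;
named consumer: the Albanese range hypothesis plan `ALB-H1-ISO-PLAN` (b10 lineage), step S5.

## References

* [VoisinHodgeI2002] C. Voisin, Hodge Theory and Complex Algebraic Geometry I, CUP (2002), §7.2.2
  Lemma 7.15 (PDF pp. 141–143), §7.1.2 Def. 7.7, §7.3.1.
* [LangeBirkenhake1992] H. Lange, Ch. Birkenhake, Complex Abelian Varieties, Springer (1992), §2.1
  Prop. 2.1.11, Thm. 2.1.13; §2.4, §2.5.1 Prop. 2.5.1; §4.2 Thm. 4.2.1; §1.1 Lemma 1.1.17, Thm. 1.1.21.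
* [Lange2023AbelianVarietiesComplex] H. Lange, Abelian Varieties over the Complex Numbers (2023), §1.1.3
  Lemma 1.1.17.
-/

noncomputable section

-- Nested instance problems on the carrier `↥(ComplexTorus.rationalForms Φ 1)` (a `ℚ`-subspace of a
-- `ℂ`-space of `ℝ`-multilinear maps) make unification expensive at the default depth
-- (cf. `Geometry/Kaehler/ComplexTorusFirstCohomologyDuality.lean`, `ComplexTorusPolarizedHodgeStructure.lean`).
set_option maxSynthPendingDepth 3

open scoped TensorProduct

namespace Literature.AlgebraicGeometry.HodgeTheory

open Literature.AlgebraicGeometry.Motives Literature.Geometry.Kaehler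
open Literature.AlgebraicGeometry.Motives.HodgeStructure
open Module

variable {ι : Type} [Fintype ι] [DecidableEq ι] {E : Type} [NormedAddCommGroup E] [NormedSpace ℂ E]
  (Φ : (ι → ℝ) ≃L[ℝ] E)

/-! ### Step 1: period coordinates `H¹(T, ℚ) ≅ ℚ^ι` and their complexification -/

/-- **The period coordinates are the periods**: the dual-basis coordinates of the period functional
`periodDual Φ e α ∈ (ℚ^ι)^∨` of `α ∈ H¹(T, ℚ)` are `(α(Φ e_a))_a` (`ComplexTorus.oneFormPeriod`;
Lange–Birkenhake Lemma 1.1.17: `H¹(X, ℤ) = Hom(Λ, ℤ)`, a form is its periods).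
[cite: LangeBirkenhake1992, §1.1 Lemma 1.1.17] -/
theorem dualBasis_equivFun_periodDual_apply (α : ComplexTorus.rationalForms Φ 1) (a : ι) :
    (Pi.basisFun ℚ ι).dualBasis.equivFun (ComplexTorus.periodDual Φ (Pi.basisFun ℚ ι) α) a =
      ComplexTorus.oneFormPeriod Φ α a := by
  rw [Basis.equivFun_apply, Basis.dualBasis_repr, ComplexTorus.periodDual_apply,
    ComplexTorus.periodDualₗ_apply]
  simp only [Pi.basisFun_repr, Pi.basisFun_apply, Pi.single_apply, mul_ite, mul_one, mul_zero,
    Finset.sum_ite_eq', Finset.mem_univ, if_true]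

/-- **Complexified period coordinates.** For `x ∈ ℂ ⊗_ℚ H¹(T, ℚ)`, the complexified period coordinates
`(u ⊗ ℂ) x ∈ ℂ ⊗_ℚ ℚ^ι` are `Σ_b (Θ x)(Φ e_b) ⊗ e_b`, where `Θ : ℂ ⊗_ℚ H¹(T, ℚ) ≅ Alt¹_ℝ(E; ℂ)` is the
comparison `c ⊗ γ ↦ c • γ` (`ComplexTorus.complexification`) — i.e. complexifying commutes with taking
periods (Lange 2023, Lemma 1.1.17 / Cor. 1.1.19: `H¹(X, ℂ) = Hom(Λ, ℤ) ⊗ ℂ`).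
[cite: Lange2023AbelianVarietiesComplex, §1.1.3 Lemma 1.1.17] -/
theorem baseChange_periodCoord_eq_sum (x : ℂ ⊗[ℚ] ComplexTorus.rationalForms Φ 1) :
    (((ComplexTorus.periodDual Φ (Pi.basisFun ℚ ι)).trans
        (Pi.basisFun ℚ ι).dualBasis.equivFun).toLinearMap.baseChange ℂ) x =
      ∑ b, (ComplexTorus.complexification Φ 1 x) (fun _ ↦ Φ (Pi.single b 1)) ⊗ₜ[ℚ]
        Pi.single b (1 : ℚ) := by
  induction x using TensorProduct.induction_on with
  | zero => simp
  | tmul c γ =>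
    rw [LinearMap.baseChange_tmul, ComplexTorus.complexification_tmul]
    have hu : ((ComplexTorus.periodDual Φ (Pi.basisFun ℚ ι)).trans
        (Pi.basisFun ℚ ι).dualBasis.equivFun).toLinearMap γ =
        ∑ b, ComplexTorus.oneFormPeriod Φ γ b • Pi.single b (1 : ℚ) := by
      rw [LinearEquiv.coe_coe, LinearEquiv.trans_apply]
      conv_lhs => rw [← Finset.univ_sum_single
        ((Pi.basisFun ℚ ι).dualBasis.equivFun (ComplexTorus.periodDual Φ (Pi.basisFun ℚ ι) γ))]
      refine Finset.sum_congr rfl fun b _ ↦ ?_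
      rw [dualBasis_equivFun_periodDual_apply, ← Pi.single_smul', smul_eq_mul, mul_one]
    rw [hu, TensorProduct.tmul_sum]
    refine Finset.sum_congr rfl fun b _ ↦ ?_
    rw [TensorProduct.tmul_smul, TensorProduct.smul_tmul', ContinuousAlternatingMap.smul_apply,
      smul_eq_mul, ← ComplexTorus.cast_oneFormPeriod, Rat.smul_def, mul_comm]
  | add x y hx hy =>
    rw [map_add, hx, hy, map_add, ← Finset.sum_add_distrib]
    refine Finset.sum_congr rfl fun b _ ↦ ?_
    rw [ContinuousAlternatingMap.add_apply, TensorProduct.add_tmul]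

/-! ### Step 2: Riemann data on the cohomology lattice space from a polarisation of `H¹(T, ℚ)` -/

/-- **Riemann data on the cohomology lattice space of a torus with polarisable `H¹`.** If the
weight-one Hodge structure `H¹(T, ℚ)` of the complex torus `T = E/Φ(ℤ^ι)` is polarisable, there are a
complex structure `J` on `ℝ^ι = H¹(T; ℝ) = Λ^∨_ℝ` and a real alternating `J`-invariant bilinear form `B`
with `B(x, Jx) > 0` for `x ≠ 0`, RATIONAL on the standard basis, whose `(1,0)`-vectors `a + iJa` are
exactly lattice coordinates `(ℓ(Φ e_b))_b` of `ℂ`-linear functionals `ℓ` on `E` (Voisin I §7.2.2: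
"`H^{1,0}(T) = V^*`" and Lemma 7.15: a polarisation `Q` of `H¹` satisfies `Q(Ja, Jc) = Q(a, c)`,
`Q(a, Ja) > 0`). Same data tuple as `exists_cohomologyRiemannData_of_isAnalytification`. Proof: period
coordinates `u : H¹(T, ℚ) ≅ ℚ^ι` · transport (`HodgeStructure.comapEquiv`) of polarisability and
effectivity (`ComplexTorus.isEffective_hodgeStructure`) · `exists_cx_riemannForm_of_isPolarizable` ·
coordinates `ℝ ⊗_ℚ ℚ^ι ≅ ℝ^ι` · `F¹ H¹(T) = Λ^{1,0} = Hom_ℂ(E, ℂ)`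
(`ComplexTorus.mem_hodgeStructure_one_F_one_iff`, `typeOneZeroEquiv`) read through `u`
(`baseChange_periodCoord_eq_sum`).
[cite: VoisinHodgeI2002, §7.2.2 Lemma 7.15 (PDF pp. 141–143)]
[cite: LangeBirkenhake1992, §1.1 Thm. 1.1.21 and §2.1 Thm. 2.1.13] -/
theorem exists_cohomologyRiemannData_of_isPolarizable
    (hpol : (ComplexTorus.hodgeStructure Φ 1).IsPolarizable) :
    ∃ (J : (ι → ℝ) →ₗ[ℝ] (ι → ℝ)) (B : LinearMap.BilinForm ℝ (ι → ℝ)),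
      (∀ a, J (J a) = -a) ∧ (∀ x, B x x = 0) ∧ (∀ x y, B (J x) (J y) = B x y) ∧
      (∀ x, x ≠ 0 → 0 < B x (J x)) ∧
      (∀ i j, ∃ q : ℚ, B (Pi.single i 1) (Pi.single j 1) = q) ∧
      ∀ a : ι → ℝ, ∃ ℓ : E →L[ℂ] ℂ,
        ∀ b, ℓ (Φ (Pi.single b 1)) = (a b : ℂ) + (J a b : ℂ) * Complex.I := by
  -- period coordinates `u : H¹(T, ℚ) ≃ ℚ^ι` (kept opaque: only `baseChange_periodCoord_eq_sum` is used)
  obtain ⟨u, hudef⟩ : ∃ u : ComplexTorus.rationalForms Φ 1 ≃ₗ[ℚ] (ι → ℚ),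
      u = (ComplexTorus.periodDual Φ (Pi.basisFun ℚ ι)).trans (Pi.basisFun ℚ ι).dualBasis.equivFun :=
    ⟨_, rfl⟩
  -- the weight-one Hodge structure on `H¹(T, ℚ)` transported to `ℚ^ι` along `u`:
  -- polarisable (hypothesis) and effective
  have hpol' : (((ComplexTorus.hodgeStructure Φ 1).cast Nat.cast_one).comapEquiv u.symm).IsPolarizable :=
    (hpol.cast Nat.cast_one).comapEquiv u.symm
  have heff' : (((ComplexTorus.hodgeStructure Φ 1).cast Nat.cast_one).comapEquiv u.symm).IsEffective :=
    ((ComplexTorus.isEffective_hodgeStructure Φ 1).cast Nat.cast_one).comapEquiv u.symm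
  -- Riemann's linear algebra: complex structure `J` on `ℝ ⊗ ℚ^ι` and a rational Riemann form `Q`
  obtain ⟨J, hJ, Q, hQalt, hQJ, hQpos, -, hQH⟩ :=
    exists_cx_riemannForm_of_isPolarizable _ hpol' heff'
  -- coordinates `θ : ℝ ⊗_ℚ ℚ^ι ≃ ℝ^ι` (the base-changed standard basis)
  let θ : ℝ ⊗[ℚ] (ι → ℚ) ≃ₗ[ℝ] (ι → ℝ) := ((Pi.basisFun ℚ ι).baseChange ℝ).equivFun
  have hθ_basis : ∀ i, θ (((Pi.basisFun ℚ ι).baseChange ℝ) i) = Pi.single i 1 := fun i => by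
    funext j
    rw [Basis.equivFun_self, Pi.single_apply]
    simp only [eq_comm]
  have hθsymm_single : ∀ i, θ.symm (Pi.single i 1) = (1 : ℝ) ⊗ₜ[ℚ] Pi.single i (1 : ℚ) :=
    fun i => by
    rw [← hθ_basis, θ.symm_apply_apply, Basis.baseChange_apply, Pi.basisFun_apply]
  have hθ_sum : ∀ r : ι → ℝ, θ (∑ b, r b ⊗ₜ[ℚ] Pi.single b (1 : ℚ)) = r := fun r => by
    have h : ∑ b, r b ⊗ₜ[ℚ] Pi.single b (1 : ℚ) = θ.symm r := by
      rw [Basis.equivFun_symm_apply]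
      refine Finset.sum_congr rfl fun b _ => ?_
      rw [Basis.baseChange_apply, Pi.basisFun_apply, TensorProduct.smul_tmul', smul_eq_mul,
        mul_one]
    rw [h, θ.apply_symm_apply]
  -- transport `J` and `Q_ℝ` to `ℝ^ι`
  refine ⟨θ.toLinearMap ∘ₗ J ∘ₗ θ.symm.toLinearMap,
    (Q.baseChange ℝ).comp θ.symm.toLinearMap θ.symm.toLinearMap, fun a => ?_, fun x => ?_,
    fun x y => ?_, fun x hx => ?_, fun i j => ?_, fun a => ?_⟩
  · simp only [LinearMap.comp_apply, LinearEquiv.coe_coe, θ.symm_apply_apply, hJ, map_neg,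
      θ.apply_symm_apply]
  · rw [LinearMap.BilinForm.comp_apply]
    exact baseChange_real_self Q hQalt _
  · simp only [LinearMap.BilinForm.comp_apply, LinearMap.comp_apply, LinearEquiv.coe_coe,
      θ.symm_apply_apply, hQJ]
  · simp only [LinearMap.BilinForm.comp_apply, LinearMap.comp_apply, LinearEquiv.coe_coe,
      θ.symm_apply_apply]
    exact hQpos _ fun h => hx (by rw [← θ.apply_symm_apply x, h, map_zero])
  · refine ⟨Q (Pi.single i 1) (Pi.single j 1), ?_⟩
    rw [LinearMap.BilinForm.comp_apply, LinearEquiv.coe_coe, hθsymm_single, hθsymm_single,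
      LinearMap.BilinForm.baseChange_tmul, mul_one, Rat.smul_one_eq_cast]
  · -- the `(1,0)`-vector `w + iJw`, `w = θ⁻¹ a`, lies in `F¹ = cxF1 J`; read it through `u`
    have hmem : mkCx (θ.symm a) (J (θ.symm a)) ∈
        (((ComplexTorus.hodgeStructure Φ 1).cast Nat.cast_one).comapEquiv u.symm).F 1 := by
      rw [← hQH, hodgeStructureOfCx_F_one]
      exact mkCx_mem_cxF1 J hJ _
    rw [comapEquiv_F, Submodule.mem_comap, cast_F, ComplexTorus.mem_hodgeStructure_one_F_one_iff]
      at hmem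
    -- the `(1,0)`-form `ψ = Θ (u⁻¹ ⊗ ℂ)(w + iJw)` and its `ℂ`-linear functional `ℓ`
    obtain ⟨x, hxdef⟩ : ∃ x : ℂ ⊗[ℚ] ComplexTorus.rationalForms Φ 1,
        x = u.symm.toLinearMap.baseChange ℂ (mkCx (θ.symm a) (J (θ.symm a))) := ⟨_, rfl⟩
    rw [← hxdef] at hmem
    obtain ⟨ψ, hψdef⟩ : ∃ ψ : E [⋀^Fin 1]→L[ℝ] ℂ, ψ = ComplexTorus.complexification Φ 1 x := ⟨_, rfl⟩
    rw [← hψdef] at hmem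
    obtain ⟨ℓ, hℓψ⟩ : ∃ ℓ : E →L[ℂ] ℂ, (typeOneZeroEquiv ℓ : E [⋀^Fin 1]→L[ℝ] ℂ) = ψ :=
      ⟨typeOneZeroEquiv.symm ⟨ψ, hmem⟩, by rw [LinearEquiv.apply_symm_apply]⟩
    have hℓv : ∀ v : E, ψ (fun _ ↦ v) = ℓ v := fun v => by
      rw [← hℓψ, coe_typeOneZeroEquiv, oneForm_apply, ContinuousLinearMap.coe_restrictScalars']
    -- `w + iJw = (u ⊗ ℂ) x = Σ_b ψ(Φ e_b) ⊗ e_b = Σ_b ℓ(Φ e_b) ⊗ e_b`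
    have hux : u.toLinearMap.baseChange ℂ x = mkCx (θ.symm a) (J (θ.symm a)) := by
      rw [hxdef]
      exact baseChange_apply_symm_baseChange u _
    have hℓ : mkCx (θ.symm a) (J (θ.symm a)) =
        ∑ b, ℓ (Φ (Pi.single b 1)) ⊗ₜ[ℚ] Pi.single b (1 : ℚ) := by
      have h := baseChange_periodCoord_eq_sum Φ x
      rw [← hudef, hux, ← hψdef] at h
      rw [h]
      exact Finset.sum_congr rfl fun b _ ↦ by rw [hℓv]
    -- take real and imaginary parts and coordinates
    refine ⟨ℓ, fun b => ?_⟩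
    have hre := congrArg rePart hℓ
    have him := congrArg imPart hℓ
    rw [rePart_mkCx, map_sum] at hre
    rw [imPart_mkCx, map_sum] at him
    simp only [rePart_tmul] at hre
    simp only [imPart_tmul] at him
    have ha : a = fun c => (ℓ (Φ (Pi.single c 1))).re := by
      rw [← θ.apply_symm_apply a, hre, hθ_sum]
    have hJa : θ (J (θ.symm a)) = fun c => (ℓ (Φ (Pi.single c 1))).im := by
      rw [him, hθ_sum]
    rw [LinearMap.comp_apply, LinearMap.comp_apply, LinearEquiv.coe_coe, LinearEquiv.coe_coe, hJa,
      show a b = (ℓ (Φ (Pi.single b 1))).re from congrFun ha b]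
    exact (Complex.re_add_im _).symm

/-! ### Step 3: assembly -/

/-- **A complex torus with polarisable `H¹` admits a Riemann form** (Voisin I §7.2.2, Lemma 7.15 and
the sentence following it; Lange–Birkenhake Thm. 4.2.1 / Thm. 2.1.13 with §2.4–§2.5): if the weight-one
`ℚ`-Hodge structure `ComplexTorus.hodgeStructure Φ 1` on `H¹(T, ℚ)` of `T = E/Φ(ℤ^ι)` is polarisable, then
`ComplexTorus.IsAbelianVariety Φ` — there is a real alternating bilinear form on `ℝ^ι`, invariant under
`J_Φ = Φ⁻¹ ∘ i ∘ Φ`, integral on `ℤ^ι`, with `B(J_Φ x, x) > 0` for `x ≠ 0`. Proof: Riemann data `(J, B₁)`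
on the cohomology lattice space (`exists_cohomologyRiemannData_of_isPolarizable`), `J = -J_Φᵀ`
(`dotProduct_latticeJ_eq_neg`), the dual Riemann data `B₂ = B₁⁻¹` for `J_Φ`
(`Literature.LinearAlgebra.exists_dualRiemannData`, the dual polarisation, Lange–Birkenhake §2.5.1),
clearing denominators (`exists_nat_pos_mul_eq_int`) and `ComplexTorus.isAbelianVariety_of_bilinForm`.
[cite: VoisinHodgeI2002, §7.2.2 Lemma 7.15 (PDF pp. 141–143)]
[cite: LangeBirkenhake1992, §2.1 Thm. 2.1.13, §2.5.1 Prop. 2.5.1 and §4.2 Thm. 4.2.1] -/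
theorem isAbelianVariety_of_isPolarizable_hodgeStructure_one
    (hpol : (ComplexTorus.hodgeStructure Φ 1).IsPolarizable) : ComplexTorus.IsAbelianVariety Φ := by
  obtain ⟨J, B, hJ, h0, hinv, hpos, hrat, hF⟩ := exists_cohomologyRiemannData_of_isPolarizable Φ hpol
  have hadj := dotProduct_latticeJ_eq_neg Φ J hF
  obtain ⟨B₂, h0₂, hinv₂, hpos₂, hrat₂⟩ :=
    Literature.LinearAlgebra.exists_dualRiemannData J (ComplexTorus.latticeJ Φ) hJ hadj B h0 hinv
      hpos hrat
  choose q hq using hrat₂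
  obtain ⟨N, hN, hk⟩ := exists_nat_pos_mul_eq_int fun ij : ι × ι => q ij.1 ij.2
  refine ComplexTorus.isAbelianVariety_of_bilinForm Φ (B := (N : ℝ) • B₂) (fun x => ?_)
    (fun x y => ?_) (fun i j => ?_) (fun x hx => ?_)
  · simp only [LinearMap.smul_apply, smul_eq_mul, h0₂, mul_zero]
  · simp only [LinearMap.smul_apply, smul_eq_mul, hinv₂]
  · obtain ⟨k, hk'⟩ := hk (i, j)
    refine ⟨k, ?_⟩
    simp only [LinearMap.smul_apply, smul_eq_mul, hq]
    exact_mod_cast hk'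
  · simp only [LinearMap.smul_apply, smul_eq_mul]
    exact mul_pos (by exact_mod_cast hN) (hpos₂ x hx)

/-- **A complex torus of positive dimension is an abelian variety iff its weight-one Hodge structure
`H¹(T, ℚ)` is polarisable** (Voisin I §7.2.2, after Lemma 7.15; Lange–Birkenhake Thm. 4.2.1). The
direction "⇒" is the tree's `ComplexTorus.IsRiemannForm.isPolarizable_hodgeStructure_one'` (the
alternating intersection form `∫ ω^{g-1} ∧ α ∧ β` of the Hodge metric of a Riemann form polarises `H¹`),
"⇐" is `isAbelianVariety_of_isPolarizable_hodgeStructure_one`.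
[cite: VoisinHodgeI2002, §7.2.2 Lemma 7.15 (PDF pp. 141–143)] [cite: LangeBirkenhake1992, §4.2 Thm. 4.2.1] -/
theorem isAbelianVariety_iff_isPolarizable_hodgeStructure_one [FiniteDimensional ℂ E]
    (hE : 0 < finrank ℂ E) :
    ComplexTorus.IsAbelianVariety Φ ↔ (ComplexTorus.hodgeStructure Φ 1).IsPolarizable :=
  ⟨fun ⟨_, hη⟩ => hη.isPolarizable_hodgeStructure_one' Φ hE,
    isAbelianVariety_of_isPolarizable_hodgeStructure_one Φ⟩

/-- **Consumer form: an injective morphism of Hodge structures from `H¹(T, ℚ)` into a polarisable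
weight-one Hodge structure makes `T` an abelian variety.** If `f : H¹(T, ℚ) → H` is a morphism of
`ℚ`-Hodge structures of weight one with injective underlying linear map and `H` is polarisable, then
`ComplexTorus.IsAbelianVariety Φ` (pull the polarisation back along `f`,
`HodgeStructure.Polarization.comap`: a sub-Hodge structure of a polarised Hodge structure is polarised,
Voisin I §7.3.1; then `isAbelianVariety_of_isPolarizable_hodgeStructure_one`). Typical use: `f = φ^*` for
a holomorphic map `φ : Y → T` from a smooth projective `Y` inducing a surjection on `H₁(−; ℚ)` (then
`φ^*` is injective on `H¹` and `H¹(Y(ℂ); ℚ)` is polarised by the Hodge–Riemann relations).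
[cite: VoisinHodgeI2002, §7.1.2 Def. 7.7, §7.2.2 Lemma 7.15 and §7.3.1] -/
theorem isAbelianVariety_of_hom_injective {W : Type*} [AddCommGroup W] [Module ℚ W]
    {H : HodgeStructure W 1} (hH : H.IsPolarizable)
    (f : Hom (ComplexTorus.hodgeStructure Φ 1) H)
    (hf : Function.Injective f.toLinearMap) : ComplexTorus.IsAbelianVariety Φ :=
  isAbelianVariety_of_isPolarizable_hodgeStructure_one Φ ⟨hH.some.comap f hf⟩

/-- **Geometric consumer form: a complex torus receiving the first cohomology of a smooth projective
variety injectively is an abelian variety.** For `X/ℂ` smooth projective of dimension `n` with a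
Hodge-symmetric Hodge model `B` (so that `H¹(X(ℂ); ℚ)` carries the weight-one Hodge structure
`B.hodgeStructure hX hB 1`, polarised by the Hodge–Riemann bilinear relations,
`smoothProjective_hodgeStructure_isPolarizable_holds`), every morphism of Hodge structures
`f : H¹(T, ℚ) → H¹(X(ℂ); ℚ)` with injective underlying map — e.g. `f = α^*` for a holomorphic
`α : X^an → T` with `α_* π₁(X) ↠ π₁(T)`, the situation of an Albanese map — forces
`ComplexTorus.IsAbelianVariety Φ` (Voisin I §7.2.2 Lemma 7.15 with §7.3.1; Lange–Birkenhake Thm. 4.2.1).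
[cite: VoisinHodgeI2002, §7.2.2 Lemma 7.15 and §7.3.1] [cite: LangeBirkenhake1992, §4.2 Thm. 4.2.1] -/
theorem isAbelianVariety_of_hom_hodgeModel_injective {n : ℕ} {X : SchemeOver ℂ}
    (hX : IsSmoothProjective n X) (B : HodgeModel n X) (hB : B.IsHodgeSymmetric)
    (f : Hom (ComplexTorus.hodgeStructure Φ 1) (B.hodgeStructure hX hB 1))
    (hf : Function.Injective f.toLinearMap) : ComplexTorus.IsAbelianVariety Φ :=
  isAbelianVariety_of_isPolarizable_hodgeStructure_one Φ
    ⟨(smoothProjective_hodgeStructure_isPolarizable_holds hX B hB 1).some.comap f hf⟩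

end Literature.AlgebraicGeometry.HodgeTheory

end
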